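import Mathlib
import HarnessLib
import Literature.MathematicalPhysics.QuantumLattice.HubbardUVSymbolFrameShiftDecay
import Summits.HubbardSuperconductivity.HubbardSuperconductivity.Theorems.KLProgrammeKLRegimeSplitPredicates

/-!
# K3 gen-8-FLOW (stmt 20437 `KLRegimeEngineV17F2`, stub (C), located risk «(C)-B-REP» item (γ)): the SHARP `ℓ¹` frame-shift bound of the one-shot
# ultraviolet symbol — band decay + density of states: `Σ_{(ω,k⃗,σ)} ‖Ψ_{K₁} − Ψ_{K₀}‖ ≤ 8(2B₁+1)·βL²·β·fd·[c₁L²(2 + 4J) + 6c₂L/Λ + L²/(2^J Λ − fd)]`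

Cell gate-hubbard-kl, seat p2 g12; pen ruling (R59c) (KL STATUS 2026-08-27 18:15:15Z): «(γ) GO now (sharp ℓ¹ of `Ψ_{K₁} − Ψ_{K₀}` … under a DOS hypothesis
`hDOS` stated as an explicit Prop binder)».  The landed `…EngineFrameShiftResponse.sum_norm_uvSymbolCT_sub_le` (p525713) bounds the sum by
`2L²·((2B₁+1)βL²)·(2β/Λ)·frameDist` — the factor `β/Λ` comes from using the ENVELOPE `1/max(|ω|,Λ/2)²` at every momentum (no decay in the band) and is the
`4^n` of memo B-DOOR-LAW-p2g12 §2(b).  With the band decay of `Literature/…/HubbardUVSymbolFrameShiftDecay.norm_uvSymbolCT_sub_le_decay` (p555642) the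
frequency sum at band distance `d` is `≤ β/max(d, Λ/2)` and the momentum sum of `1/max(d_k, Λ/2)` is a DYADIC shell sum controlled by the density of states:

* §1 `inv_max_posPart_le_dyadic`, **`sum_inv_max_posPart_le_of_count`** — generic: for values `v_k ≥ 0` on a finite index type with the counting law
  `#{v < η} ≤ c₁V·η + C₂` (`0 < η ≤ η₀`), `0 ≤ δ ≤ Λ/2`, `2^J·Λ ≤ η₀`:  `Σ_k 1/max((v_k − δ)₊, Λ/2) ≤ c₁V·(2 + 4J) + 6C₂/Λ + T/(2^JΛ − δ)` (`T` = number of indices);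
* §2 `sum_matsubaraIdx_inv_max_sq_le` — `Σ_i 1/max(ω_i² + d², Λ²/4) ≤ β/max(d, Λ/2)` (`sum_matsubaraIdx_inv_sq_add_sq_le`);
* §3 **`sum_norm_uvSymbolCT_sub_le_sharp`** — the sharp `ℓ¹` bound above, with `hDOS : ∀ η ∈ (0, η₀], #{k⃗ : |e_{K₀}(k⃗)| < η} ≤ c₁L²η + c₂L` as an explicit
  hypothesis (the shape of `…FrameShellCount.card_frameLevel_lt_le`: `(c₁, c₂, η₀) = (1793, 704, 3/80)` under `FrameOK`) and `fd ≥ sup_k⃗ |K₁(p) − K₀(p)|`.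
  At `Λ = Λ_n`, `η₀ = 3/80`: `J = ⌊log₂(η₀/Λ_n)⌋ ≤ 2n + 1`, so the bracket is `O(L²·n)`: the `β/Λ_n` of p525713 becomes `β·(2 + 4J) = O(β·n)` — the log of the memo,
  in the form the KL regime pays for (`U²·n·log 4 ≤ c`).

Proofs only; no definitions; nothing about the model's sizes is asserted; nothing asserts superconductivity.
References: BGM 2006 §2.2 (2.23), (2.36aa), §2.8 (2.80) [cite: BenfattoGiulianiMastropietro2006]; Salmhofer 1998 Lemma 4 (shell volumes).
-/

noncomputable section

namespace Summit.HubbardSuperconductivity.HubbardSuperconductivity.Theorems.EngineV8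

set_option linter.dupNamespace false -- summit = problem name (single-conjunct summit), D-0017

open Finset Literature.MathematicalPhysics.QuantumLattice Literature.Probability.LatticeModels
open Summit.HubbardSuperconductivity.HubbardSuperconductivity.Theorems.KLRegimeSplit

/-! ## §1 The dyadic shell sum of `1/max((v − δ)₊, Λ/2)` under a linear counting law -/

section Count

variable {ι : Type*} [Fintype ι]

/-- A sum of a constant over a predicate is the constant times the count. -/
theorem sum_ite_const_zero (p : ι → Prop) [DecidablePred p] (a : ℝ) :
    ∑ k, (if p k then a else (0 : ℝ)) = a * ((univ.filter p).card : ℝ) := by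
  rw [Finset.sum_ite, Finset.sum_const_zero, add_zero, Finset.sum_const, nsmul_eq_mul, mul_comm]

/-- **Pointwise dyadic majorant**: for `0 < Λ`, `δ ≤ Λ/2` and any real `v`,
`1/max((v−δ)₊, Λ/2) ≤ [v < Λ]·2/Λ + Σ_{j<J} [2^jΛ ≤ v < 2^{j+1}Λ]·2/(2^jΛ) + [2^JΛ ≤ v]·1/(2^JΛ − δ)`. -/
theorem inv_max_posPart_le_dyadic {Λ δ : ℝ} (hΛ : 0 < Λ) (hδ : δ ≤ Λ / 2) (J : ℕ) (v : ℝ) :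
    1 / max (max (v - δ) 0) (Λ / 2) ≤
      (if v < Λ then 2 / Λ else 0) +
        (∑ j ∈ range J, if (2 : ℝ) ^ j * Λ ≤ v ∧ v < (2 : ℝ) ^ (j + 1) * Λ then 2 / ((2 : ℝ) ^ j * Λ) else 0) +
        (if (2 : ℝ) ^ J * Λ ≤ v then 1 / ((2 : ℝ) ^ J * Λ - δ) else 0) := by
  have hm0 : 0 < max (max (v - δ) 0) (Λ / 2) := lt_max_of_lt_right (by positivity)
  have hsum0 : 0 ≤ ∑ j ∈ range J, (if (2 : ℝ) ^ j * Λ ≤ v ∧ v < (2 : ℝ) ^ (j + 1) * Λ then 2 / ((2 : ℝ) ^ j * Λ) else 0) :=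
    sum_nonneg fun j _ => by split_ifs <;> positivity
  have htop0 : 0 ≤ (if (2 : ℝ) ^ J * Λ ≤ v then 1 / ((2 : ℝ) ^ J * Λ - δ) else 0) := by
    split_ifs
    · have : Λ ≤ (2 : ℝ) ^ J * Λ := le_mul_of_one_le_left hΛ.le (one_le_pow₀ (by norm_num))
      have : 0 < (2 : ℝ) ^ J * Λ - δ := by linarith
      positivity
    · exact le_rfl
  by_cases hlow : v < Λ
  · -- the low shell
    rw [if_pos hlow]
    have h1 : 1 / max (max (v - δ) 0) (Λ / 2) ≤ 2 / Λ := by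
      rw [div_le_div_iff₀ hm0 hΛ, one_mul]
      nlinarith [le_max_right (max (v - δ) 0) (Λ / 2)]
    linarith
  · rw [if_neg hlow, zero_add]
    have hvΛ : Λ ≤ v := not_lt.1 hlow
    by_cases htop : (2 : ℝ) ^ J * Λ ≤ v
    · -- the top region
      rw [if_pos htop]
      have hpos : 0 < (2 : ℝ) ^ J * Λ - δ := by
        have : Λ ≤ (2 : ℝ) ^ J * Λ := le_mul_of_one_le_left hΛ.le (one_le_pow₀ (by norm_num))
        linarith
      have h1 : 1 / max (max (v - δ) 0) (Λ / 2) ≤ 1 / ((2 : ℝ) ^ J * Λ - δ) := by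
        refine one_div_le_one_div_of_le hpos ?_
        exact le_trans (by linarith) (le_trans (le_max_left _ _) (le_max_left _ _))
      linarith
    · -- a dyadic shell `2^jΛ ≤ v < 2^{j+1}Λ` with `j < J`
      rw [if_neg htop, add_zero]
      have hx : 1 ≤ v / Λ := by rw [le_div_iff₀ hΛ, one_mul]; exact hvΛ
      obtain ⟨n, hn1, hn2⟩ := exists_nat_pow_near hx (show (1 : ℝ) < 2 by norm_num)
      have hn1' : (2 : ℝ) ^ n * Λ ≤ v := by rwa [le_div_iff₀ hΛ] at hn1
      have hn2' : v < (2 : ℝ) ^ (n + 1) * Λ := by rwa [div_lt_iff₀ hΛ] at hn2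
      have hnJ : n < J := by
        by_contra hge
        have hge' : J ≤ n := not_lt.1 hge
        have : (2 : ℝ) ^ J * Λ ≤ (2 : ℝ) ^ n * Λ := mul_le_mul_of_nonneg_right (pow_le_pow_right₀ (by norm_num) hge') hΛ.le
        exact htop (this.trans hn1')
      have hterm : 2 / ((2 : ℝ) ^ n * Λ) ≤
          ∑ j ∈ range J, (if (2 : ℝ) ^ j * Λ ≤ v ∧ v < (2 : ℝ) ^ (j + 1) * Λ then 2 / ((2 : ℝ) ^ j * Λ) else 0) := by
        have h := single_le_sum (f := fun j => (if (2 : ℝ) ^ j * Λ ≤ v ∧ v < (2 : ℝ) ^ (j + 1) * Λ then 2 / ((2 : ℝ) ^ j * Λ) else 0))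
          (fun j _ => by split_ifs <;> positivity) (mem_range.mpr hnJ)
        simp only [hn1', hn2', and_self, if_true] at h
        exact h
      have h2n : 0 < (2 : ℝ) ^ n * Λ := by positivity
      have h1 : 1 / max (max (v - δ) 0) (Λ / 2) ≤ 2 / ((2 : ℝ) ^ n * Λ) := by
        rw [div_le_div_iff₀ hm0 h2n, one_mul]
        have hge : v - δ ≤ max (max (v - δ) 0) (Λ / 2) := le_trans (le_max_left _ _) (le_max_left _ _)
        have h2 : (1 : ℝ) ≤ (2 : ℝ) ^ n := one_le_pow₀ (by norm_num)
        nlinarith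
      linarith

/-- **The dyadic shell sum under a linear counting law**: `v` on a finite index type, `#{v < η} ≤ c₁V·η + C₂` for `0 < η ≤ η₀` (`C₂ ≥ 0`), `0 < Λ`, `δ ≤ Λ/2`,
`2^J·Λ ≤ η₀` ⟹ `Σ_k 1/max((v_k − δ)₊, Λ/2) ≤ c₁V·(2 + 4J) + 6C₂/Λ + (#ι)/(2^JΛ − δ)`. -/
theorem sum_inv_max_posPart_le_of_count (v : ι → ℝ) {Λ δ η₀ c₁V C₂ : ℝ} (hΛ : 0 < Λ)
    (hδ : δ ≤ Λ / 2) (hC₂ : 0 ≤ C₂) (J : ℕ) (hJ : (2 : ℝ) ^ J * Λ ≤ η₀)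
    (hcount : ∀ η : ℝ, 0 < η → η ≤ η₀ → ((univ.filter fun k => v k < η).card : ℝ) ≤ c₁V * η + C₂) :
    ∑ k, 1 / max (max (v k - δ) 0) (Λ / 2) ≤ c₁V * (2 + 4 * J) + 6 * C₂ / Λ + (Fintype.card ι : ℝ) / ((2 : ℝ) ^ J * Λ - δ) := by
  classical
  have hΛη : Λ ≤ η₀ := le_trans (le_mul_of_one_le_left hΛ.le (one_le_pow₀ (by norm_num))) hJ
  have htopden : 0 < (2 : ℝ) ^ J * Λ - δ := by
    have : Λ ≤ (2 : ℝ) ^ J * Λ := le_mul_of_one_le_left hΛ.le (one_le_pow₀ (by norm_num))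
    linarith
  -- sum the pointwise majorant
  have hpt := fun k => inv_max_posPart_le_dyadic hΛ hδ J (v k)
  refine (sum_le_sum fun k _ => hpt k).trans ?_
  rw [sum_add_distrib, sum_add_distrib, sum_ite_const_zero, sum_ite_const_zero, sum_comm]
  simp_rw [sum_ite_const_zero]
  -- the three counts
  have hlow : ((univ.filter fun k => v k < Λ).card : ℝ) ≤ c₁V * Λ + C₂ := hcount Λ hΛ hΛη
  have hshell : ∀ j ∈ range J, ((univ.filter fun k => (2 : ℝ) ^ j * Λ ≤ v k ∧ v k < (2 : ℝ) ^ (j + 1) * Λ).card : ℝ) ≤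
      c₁V * ((2 : ℝ) ^ (j + 1) * Λ) + C₂ := by
    intro j hj
    have hjJ : j + 1 ≤ J := mem_range.mp hj
    have hη : (2 : ℝ) ^ (j + 1) * Λ ≤ η₀ :=
      le_trans (mul_le_mul_of_nonneg_right (pow_le_pow_right₀ (by norm_num) hjJ) hΛ.le) hJ
    refine le_trans ?_ (hcount _ (by positivity) hη)
    exact_mod_cast card_le_card (fun k hk => by
      simp only [mem_filter, mem_univ, true_and] at hk ⊢
      exact hk.2)
  have htop : ((univ.filter fun k => (2 : ℝ) ^ J * Λ ≤ v k).card : ℝ) ≤ Fintype.card ι := by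
    exact_mod_cast (card_le_card (filter_subset _ _)).trans (card_univ (α := ι)).le
  -- assemble
  have h1 : 2 / Λ * ((univ.filter fun k => v k < Λ).card : ℝ) ≤ 2 * c₁V + 2 * C₂ / Λ := by
    calc 2 / Λ * ((univ.filter fun k => v k < Λ).card : ℝ) ≤ 2 / Λ * (c₁V * Λ + C₂) := mul_le_mul_of_nonneg_left hlow (by positivity)
      _ = 2 * c₁V + 2 * C₂ / Λ := by field_simp
  have h2 : ∑ j ∈ range J, 2 / ((2 : ℝ) ^ j * Λ) *
      ((univ.filter fun k => (2 : ℝ) ^ j * Λ ≤ v k ∧ v k < (2 : ℝ) ^ (j + 1) * Λ).card : ℝ) ≤ 4 * c₁V * J + 4 * C₂ / Λ := by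
    have hterm : ∀ j ∈ range J, 2 / ((2 : ℝ) ^ j * Λ) *
        ((univ.filter fun k => (2 : ℝ) ^ j * Λ ≤ v k ∧ v k < (2 : ℝ) ^ (j + 1) * Λ).card : ℝ) ≤ 4 * c₁V + 2 * C₂ / Λ * ((2 : ℝ)⁻¹) ^ j := by
      intro j hj
      calc _ ≤ 2 / ((2 : ℝ) ^ j * Λ) * (c₁V * ((2 : ℝ) ^ (j + 1) * Λ) + C₂) := mul_le_mul_of_nonneg_left (hshell j hj) (by positivity)
        _ = 4 * c₁V + 2 * C₂ / Λ * ((2 : ℝ)⁻¹) ^ j := by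
            have h2j : (2 : ℝ) ^ j ≠ 0 := pow_ne_zero _ (by norm_num)
            rw [inv_pow]
            field_simp
            ring
    refine (sum_le_sum hterm).trans ?_
    rw [sum_add_distrib, sum_const, card_range, nsmul_eq_mul, ← mul_sum]
    have hgeom : ∑ j ∈ range J, ((2 : ℝ)⁻¹) ^ j ≤ 2 := by
      have := geom_sum_Ico_le_of_lt_one (show (0 : ℝ) ≤ 2⁻¹ by norm_num) (show (2 : ℝ)⁻¹ < 1 by norm_num) (m := 0) (n := J)
      rw [range_eq_Ico]
      refine this.trans (le_of_eq ?_)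
      norm_num
    have : 2 * C₂ / Λ * ∑ j ∈ range J, ((2 : ℝ)⁻¹) ^ j ≤ 2 * C₂ / Λ * 2 := mul_le_mul_of_nonneg_left hgeom (by positivity)
    have e2 : (J : ℝ) * (4 * c₁V) = 4 * c₁V * J := by ring
    have e3 : 4 * C₂ / Λ = 2 * (2 * C₂ / Λ) := by ring
    linarith
  have h3 : 1 / ((2 : ℝ) ^ J * Λ - δ) * ((univ.filter fun k => (2 : ℝ) ^ J * Λ ≤ v k).card : ℝ) ≤
      (Fintype.card ι : ℝ) / ((2 : ℝ) ^ J * Λ - δ) := by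
    rw [one_div_mul_eq_div]
    exact div_le_div_of_nonneg_right htop htopden.le
  have e1 : c₁V * (2 + 4 * (J : ℝ)) = 2 * c₁V + 4 * c₁V * J := by ring
  have e4 : 6 * C₂ / Λ = 2 * C₂ / Λ + 4 * C₂ / Λ := by ring
  linarith

end Count

/-! ## §2 The Matsubara sum at band distance `d` -/

/-- **`Σ_i 1/max(ω_i² + d², Λ²/4) ≤ β/max(d, Λ/2)`** (`0 < β`, `0 < Λ`, `0 ≤ d`): `max(A, B) ≥ (A+B)/2` and `Σ_i 1/(ω_i² + a²) ≤ β/(2a)` at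
`a = √(d² + Λ²/4) ≥ max(d, Λ/2)`. -/
theorem sum_matsubaraIdx_inv_max_sq_le {β Λ d : ℝ} (hβ : 0 < β) (hΛ : 0 < Λ) (hd : 0 ≤ d) (M : ℕ) :
    ∑ i : MatsubaraIdx M, 1 / max (matsubaraFreq β M i ^ 2 + d ^ 2) (Λ ^ 2 / 4) ≤ β / max d (Λ / 2) := by
  set a : ℝ := Real.sqrt (d ^ 2 + Λ ^ 2 / 4) with ha
  have ha2 : a ^ 2 = d ^ 2 + Λ ^ 2 / 4 := by rw [ha, Real.sq_sqrt (by positivity)]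
  have hapos : 0 < a := by rw [ha]; exact Real.sqrt_pos.2 (by positivity)
  have had : max d (Λ / 2) ≤ a := by
    refine max_le ?_ ?_
    · exact (Real.le_sqrt hd (by positivity)).2 (by nlinarith [sq_nonneg Λ])
    · exact (Real.le_sqrt (by positivity) (by positivity)).2 (by nlinarith [sq_nonneg d])
  have hm0 : 0 < max d (Λ / 2) := lt_max_of_lt_right (by positivity)
  have hterm : ∀ i : MatsubaraIdx M, 1 / max (matsubaraFreq β M i ^ 2 + d ^ 2) (Λ ^ 2 / 4) ≤ 2 * (1 / (matsubaraFreq β M i ^ 2 + a ^ 2)) := by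
    intro i
    have hmx : 0 < max (matsubaraFreq β M i ^ 2 + d ^ 2) (Λ ^ 2 / 4) := lt_max_of_lt_right (by positivity)
    rw [ha2, mul_one_div, div_le_div_iff₀ hmx (by positivity), one_mul]
    nlinarith [le_max_left (matsubaraFreq β M i ^ 2 + d ^ 2) (Λ ^ 2 / 4), le_max_right (matsubaraFreq β M i ^ 2 + d ^ 2) (Λ ^ 2 / 4)]
  calc ∑ i : MatsubaraIdx M, 1 / max (matsubaraFreq β M i ^ 2 + d ^ 2) (Λ ^ 2 / 4)
      ≤ ∑ i : MatsubaraIdx M, 2 * (1 / (matsubaraFreq β M i ^ 2 + a ^ 2)) := sum_le_sum fun i _ => hterm i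
    _ = 2 * ∑ i : MatsubaraIdx M, 1 / (matsubaraFreq β M i ^ 2 + a ^ 2) := by rw [mul_sum]
    _ ≤ 2 * (β / (2 * a)) := mul_le_mul_of_nonneg_left (sum_matsubaraIdx_inv_sq_add_sq_le hβ hapos M) (by norm_num)
    _ = β / a := by field_simp
    _ ≤ β / max d (Λ / 2) := div_le_div_of_nonneg_left hβ.le hm0 had

/-! ## §3 The sharp `ℓ¹` frame-shift bound -/

section Model

variable {L M : ℕ} [NeZero L]

/-- **SHARP `ℓ¹` FRAME-SHIFT BOUND OF THE ONE-SHOT SYMBOL** (band decay + density of states): for two frames `K₀, K₁` with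
`|K₁(p_k⃗) − K₀(p_k⃗)| ≤ fd ≤ Λ/2` and the counting law `hDOS` of the band `e_{K₀}` on the torus grid,
`Σ_{(ω,k⃗,σ)} ‖Ψ_{K₁} − Ψ_{K₀}‖ ≤ 8(2B₁+1)·βL²·β·fd·[c₁L²·(2 + 4J) + 6c₂L/Λ + L²/(2^JΛ − fd)]` whenever `2^J·Λ ≤ η₀`. -/
theorem sum_norm_uvSymbolCT_sub_le_sharp {B₁ : ℝ} (hB₁ : ∀ y, |deriv salmhoferCutoff y| ≤ B₁) {β : ℝ} (hβ : 0 < β) {Λ : ℝ} (hΛ : 0 < Λ)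
    (μ : ℝ) (K₀ K₁ : TrigPolyC4v) {fd : ℝ} (hfd0 : 0 ≤ fd) (hfdΛ : fd ≤ Λ / 2)
    (hfd : ∀ kv : TorusSite 2 L, |K₁.eval (latticeMomentum L kv) - K₀.eval (latticeMomentum L kv)| ≤ fd)
    {η₀ c₁ c₂ : ℝ} (hc₂ : 0 ≤ c₂) (J : ℕ) (hJ : (2 : ℝ) ^ J * Λ ≤ η₀)
    (hDOS : ∀ η : ℝ, 0 < η → η ≤ η₀ →
      ((univ.filter fun kv : TorusSite 2 L => |nambuXiCT L μ K₀ kv| < η).card : ℝ) ≤ c₁ * (L : ℝ) ^ 2 * η + c₂ * L) :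
    ∑ ks : FreqMomentum L M × Fin 2, ‖uvSymbolCT L M β μ K₁ Λ ks - uvSymbolCT L M β μ K₀ Λ ks‖ ≤
      8 * (2 * B₁ + 1) * (β * (L : ℝ) ^ 2) * β * fd *
        (c₁ * (L : ℝ) ^ 2 * (2 + 4 * J) + 6 * (c₂ * L) / Λ + (L : ℝ) ^ 2 / ((2 : ℝ) ^ J * Λ - fd)) := by
  classical
  have hB10 : 0 ≤ B₁ := (abs_nonneg _).trans (hB₁ 0)
  have hL : (0 : ℝ) < L := by exact_mod_cast NeZero.pos L
  set C : ℝ := 4 * ((2 * B₁ + 1) * (β * (L : ℝ) ^ 2)) with hC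
  have hC0 : 0 ≤ C := by positivity
  set dk : TorusSite 2 L → ℝ := fun kv => max (|nambuXiCT L μ K₀ kv| - fd) 0 with hdk
  have hdk0 : ∀ kv, 0 ≤ dk kv := fun kv => le_max_right _ _
  -- per-mode bound with the band decay, uniform in the spin, at distance `dk`
  have hmode : ∀ (i : MatsubaraIdx M) (kv : TorusSite 2 L) (σ : Fin 2),
      ‖uvSymbolCT L M β μ K₁ Λ ((i, kv), σ) - uvSymbolCT L M β μ K₀ Λ ((i, kv), σ)‖ ≤
        C * fd * (1 / max (matsubaraFreq β M i ^ 2 + dk kv ^ 2) (Λ ^ 2 / 4)) := by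
    intro i kv σ
    have h := norm_uvSymbolCT_sub_le_decay (L := L) (M := M) hB₁ hβ hΛ μ K₁ K₀ i kv σ
    set δ := |K₁.eval (latticeMomentum L kv) - K₀.eval (latticeMomentum L kv)| with hδ
    set d' := max (|nambuXiCT L μ K₀ kv| - δ) 0 with hd'
    have hδfd : δ ≤ fd := hfd kv
    have hd'dk : dk kv ≤ d' := max_le_max (by linarith) le_rfl
    have hmx0 : 0 < max (matsubaraFreq β M i ^ 2 + dk kv ^ 2) (Λ ^ 2 / 4) := lt_max_of_lt_right (by positivity)
    have hmono : 1 / max (matsubaraFreq β M i ^ 2 + d' ^ 2) (Λ ^ 2 / 4) ≤ 1 / max (matsubaraFreq β M i ^ 2 + dk kv ^ 2) (Λ ^ 2 / 4) :=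
      one_div_le_one_div_of_le hmx0 (max_le_max (by nlinarith [pow_le_pow_left₀ (hdk0 kv) hd'dk 2]) le_rfl)
    calc _ ≤ C / max (matsubaraFreq β M i ^ 2 + d' ^ 2) (Λ ^ 2 / 4) * δ := h
      _ = C * δ * (1 / max (matsubaraFreq β M i ^ 2 + d' ^ 2) (Λ ^ 2 / 4)) := by ring
      _ ≤ C * fd * (1 / max (matsubaraFreq β M i ^ 2 + dk kv ^ 2) (Λ ^ 2 / 4)) :=
          mul_le_mul (mul_le_mul_of_nonneg_left hδfd hC0) hmono (by positivity) (by positivity)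
  -- reorganise the sum: legs → (frequency, momentum) → momentum outside
  have hsplit : ∑ ks : FreqMomentum L M × Fin 2, ‖uvSymbolCT L M β μ K₁ Λ ks - uvSymbolCT L M β μ K₀ Λ ks‖ ≤
      ∑ kv : TorusSite 2 L, 2 * (C * fd) * ∑ i : MatsubaraIdx M, 1 / max (matsubaraFreq β M i ^ 2 + dk kv ^ 2) (Λ ^ 2 / 4) := by
    rw [Fintype.sum_prod_type, Fintype.sum_prod_type, sum_comm]
    refine sum_le_sum fun kv _ => ?_
    rw [mul_sum]
    refine sum_le_sum fun i _ => ?_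
    calc ∑ σ : Fin 2, ‖uvSymbolCT L M β μ K₁ Λ ((i, kv), σ) - uvSymbolCT L M β μ K₀ Λ ((i, kv), σ)‖
        ≤ ∑ _σ : Fin 2, C * fd * (1 / max (matsubaraFreq β M i ^ 2 + dk kv ^ 2) (Λ ^ 2 / 4)) := sum_le_sum fun σ _ => hmode i kv σ
      _ = 2 * (C * fd) * (1 / max (matsubaraFreq β M i ^ 2 + dk kv ^ 2) (Λ ^ 2 / 4)) := by
          rw [sum_const, card_univ, Fintype.card_fin, nsmul_eq_mul]; ring
  refine hsplit.trans ?_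
  -- the frequency sum at distance `dk`, then the dyadic momentum sum
  have hfreq : ∀ kv, ∑ i : MatsubaraIdx M, 1 / max (matsubaraFreq β M i ^ 2 + dk kv ^ 2) (Λ ^ 2 / 4) ≤ β / max (dk kv) (Λ / 2) :=
    fun kv => sum_matsubaraIdx_inv_max_sq_le hβ hΛ (hdk0 kv) M
  have hcount := sum_inv_max_posPart_le_of_count (ι := TorusSite 2 L) (fun kv => |nambuXiCT L μ K₀ kv|) hΛ hfdΛ
    (c₁V := c₁ * (L : ℝ) ^ 2) (C₂ := c₂ * L) (by positivity) J hJ hDOS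
  have hcard : (Fintype.card (TorusSite 2 L) : ℝ) = (L : ℝ) ^ 2 := by
    rw [Fintype.card_pi, Fin.prod_const, ZMod.card]; push_cast; ring
  rw [hcard] at hcount
  calc ∑ kv : TorusSite 2 L, 2 * (C * fd) * ∑ i : MatsubaraIdx M, 1 / max (matsubaraFreq β M i ^ 2 + dk kv ^ 2) (Λ ^ 2 / 4)
      ≤ ∑ kv : TorusSite 2 L, 2 * (C * fd) * (β / max (dk kv) (Λ / 2)) :=
        sum_le_sum fun kv _ => mul_le_mul_of_nonneg_left (hfreq kv) (by positivity)
    _ = 2 * (C * fd) * β * ∑ kv : TorusSite 2 L, 1 / max (max (|nambuXiCT L μ K₀ kv| - fd) 0) (Λ / 2) := by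
        rw [mul_sum]
        exact sum_congr rfl fun kv _ => by rw [hdk]; ring
    _ ≤ 2 * (C * fd) * β * (c₁ * (L : ℝ) ^ 2 * (2 + 4 * J) + 6 * (c₂ * L) / Λ + (L : ℝ) ^ 2 / ((2 : ℝ) ^ J * Λ - fd)) :=
        mul_le_mul_of_nonneg_left hcount (by positivity)
    _ = _ := by rw [hC]; ring

end Model

end Summit.HubbardSuperconductivity.HubbardSuperconductivity.Theorems.EngineV8

end
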